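import Summits.AtomisticToContinuum.Crystallization.Theses.ChessboardParticlePlanes
import Literature.MathematicalPhysics.StatisticalMechanics.LocalMatchingCompactness

/-!
# Crux `PeriodicWindows` (stmt-AtomisticToContinuum-3240), line `Sketch` — stub `stub_cleanLimit`

Step S3b1 of the lead skeleton `PeriodicWindowsSketch` (pure compactness): a sequence of
uniformly `7/10`-separated, exactly laminar, `ρ₀`-dense point sets `Xs k ⊆ ℝ³` that are CLEAN at
scale `k` (two-way `1/(k+1)`-matched, on the ball of radius `k` about each of their points `p`
of norm `≤ k`, to their own mirror image through the horizontal plane `{z = p 2}`) has a local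
limit `X'` along a subsequence which is `ρ₀`-dense, exactly laminar, `7/10`-separated and
EXACTLY mirror-symmetric through the horizontal plane of each of its points.

Proof. `exists_subseq_forall_eventually_ballMatch` extracts `φ` and the `7/10`-separated limit
`X'`; density and laminarity pass to the limit through the two-way matching as in stub S1;
for the mirror symmetry, the mirror image `m` of `q ∈ X'` through the plane of `p ∈ X'` is
approximated within `7ε` by points of `X'` for every small `ε` (match `p, q` to `a, b ∈ Xs (φ k)`,
reflect `b` through the plane of `a`, match the reflection back into `Xs (φ k)` by cleanness and
then into `X'`), and the closest point of the finite set `X' ∩ B̄(m, 1)` is `m` itself.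
-/

noncomputable section

namespace Summit.AtomisticToContinuum.Crystallization.Theorems.PeriodicWindowsSketch

open Literature.MathematicalPhysics.StatisticalMechanics Filter

/-- Coordinates are `1`-Lipschitz: `|p l - q l| ≤ dist p q` in `ℝ³`. -/
private theorem coord_sub_le_dist (p q : EuclideanSpace ℝ (Fin 3)) (l : Fin 3) :
    |p l - q l| ≤ dist p q := by
  rw [← Real.dist_eq]
  exact PiLp.dist_apply_le p q l

/-- A vertical correction costs at most its size: `‖v - t • e₃‖ ≤ ‖v‖ + |t|`. -/
private theorem norm_sub_smul_e3_le (v : EuclideanSpace ℝ (Fin 3)) (t : ℝ) :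
    ‖v - t • EuclideanSpace.single (2 : Fin 3) (1 : ℝ)‖ ≤ ‖v‖ + |t| :=
  (norm_sub_le _ _).trans (add_le_add le_rfl (le_of_eq (by simp [norm_smul])))

/-- Closest-point principle in a `7/10`-separated set `X`: if for every `ε > 0` some point of
`X` lies within `r + ε` of `c`, then some point of `X` lies within `r` of `c` (the finitely many
points of `X` in `B̄(c, r + 1)` contain a closest one). -/
private theorem exists_dist_le_of_forall_pos {X : Set (EuclideanSpace ℝ (Fin 3))}
    (hsep : ∀ p ∈ X, ∀ q ∈ X, p ≠ q → (7 : ℝ) / 10 ≤ dist p q) (c : EuclideanSpace ℝ (Fin 3))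
    (r : ℝ) (h : ∀ ε : ℝ, 0 < ε → ∃ s ∈ X, dist s c ≤ r + ε) : ∃ s ∈ X, dist s c ≤ r := by
  have hfin : (X ∩ Metric.closedBall c (r + 1)).Finite :=
    finite_of_forall_le_dist_of_subset_closedBall (by norm_num : (0 : ℝ) < 7 / 10)
      (fun p hp q hq hpq => hsep p hp.1 q hq.1 hpq) Set.inter_subset_right
  obtain ⟨s₁, hs₁, hs₁c⟩ := h 1 one_pos
  have hne : (X ∩ Metric.closedBall c (r + 1)).Nonempty :=
    ⟨s₁, hs₁, Metric.mem_closedBall.2 hs₁c⟩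
  obtain ⟨s₀, hs₀, hmin⟩ := Set.exists_min_image _ (fun s => dist s c) hfin hne
  refine ⟨s₀, hs₀.1, le_of_forall_pos_le_add fun ε hε => ?_⟩
  obtain ⟨s, hs, hsc⟩ := h (min ε 1) (lt_min hε one_pos)
  have hsS : s ∈ X ∩ Metric.closedBall c (r + 1) :=
    ⟨hs, Metric.mem_closedBall.2 (hsc.trans (by linarith [min_le_right ε 1]))⟩
  calc dist s₀ c ≤ dist s c := hmin s hsS
    _ ≤ r + min ε 1 := hsc
    _ ≤ r + ε := by linarith [min_le_left ε 1]

/-- STUB S3b1 (compactness only): uniformly `7/10`-separated, exactly laminar, `ρ₀`-dense sets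
that are clean at scale `k` around their points of norm `≤ k` have, along a subsequence, a local
limit that is `ρ₀`-dense, exactly laminar, `7/10`-separated and exactly mirror-symmetric through
the horizontal plane of each of its points. -/
theorem stub_cleanLimit (Xs : ℕ → Set (EuclideanSpace ℝ (Fin 3))) (ρ₀ : ℝ)
    (hsep : ∀ k, ∀ p ∈ Xs k, ∀ q ∈ Xs k, p ≠ q → (7 : ℝ) / 10 ≤ dist p q)
    (hlam : ∀ k, ∀ p ∈ Xs k, ∀ q ∈ Xs k, p 2 ≠ q 2 → (3 : ℝ) / 4 ≤ |p 2 - q 2|)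
    (hden : ∀ k, ∀ c : EuclideanSpace ℝ (Fin 3), ∃ p ∈ Xs k, dist p c ≤ ρ₀)
    (hclean : ∀ k : ℕ, ∀ p ∈ Xs k, dist p 0 ≤ (k : ℝ) →
      BallMatch (1 / ((k : ℝ) + 1)) k p (Xs k)
        ((fun q => q - (2 * (q 2 - p 2)) • EuclideanSpace.single (2 : Fin 3) (1 : ℝ)) '' Xs k)) :
    ∃ (φ : ℕ → ℕ) (X' : Set (EuclideanSpace ℝ (Fin 3))), StrictMono φ ∧
      (∀ R ε : ℝ, 0 < ε → ∀ᶠ k in Filter.atTop, BallMatch ε R 0 (Xs (φ k)) X') ∧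
      (∀ c : EuclideanSpace ℝ (Fin 3), ∃ p ∈ X', dist p c ≤ ρ₀) ∧
      (∀ p ∈ X', ∀ q ∈ X', p ≠ q → (7 : ℝ) / 10 ≤ dist p q) ∧
      (∀ p ∈ X', ∀ q ∈ X', p 2 ≠ q 2 → (3 : ℝ) / 4 ≤ |p 2 - q 2|) ∧
      (∀ p ∈ X', ∀ q ∈ X',
        q - (2 * (q 2 - p 2)) • EuclideanSpace.single (2 : Fin 3) (1 : ℝ) ∈ X') := by
  -- Step 1: sequential compactness in the local matching topology.
  obtain ⟨φ, X', hφ, hsep', hmatch⟩ :=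
    exists_subseq_forall_eventually_ballMatch (by norm_num : (0 : ℝ) < 7 / 10) Xs hsep
  -- Step 2: growth of the scale and decay of the cleanness defect along `φ`.
  have hkev : ∀ M : ℝ, ∀ᶠ k in atTop, M ≤ (φ k : ℝ) := fun M =>
    (tendsto_natCast_atTop_atTop.eventually_ge_atTop M).mono fun k hk =>
      hk.trans (Nat.cast_le.2 hφ.le_apply)
  have hηev : ∀ ε : ℝ, 0 < ε → ∀ᶠ k in atTop, 1 / ((φ k : ℝ) + 1) ≤ ε := fun ε hε =>
    (hkev (1 / ε)).mono fun k hk => by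
      rw [div_le_iff₀ hε] at hk
      rw [div_le_iff₀ (by positivity : (0 : ℝ) < (φ k : ℝ) + 1)]
      linarith
  -- Step 3 (conjunct 3): `ρ₀`-density of the limit.
  have hden' : ∀ c : EuclideanSpace ℝ (Fin 3), ∃ p ∈ X', dist p c ≤ ρ₀ := by
    intro c
    refine exists_dist_le_of_forall_pos hsep' c ρ₀ fun ε hε => ?_
    obtain ⟨k, hB⟩ := (hmatch (‖c‖ + ρ₀) ε hε).exists
    obtain ⟨p, hp, hpc⟩ := hden (φ k) c
    have hp0 : dist p 0 ≤ ‖c‖ + ρ₀ :=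
      calc dist p 0 ≤ dist p c + dist c 0 := dist_triangle _ _ _
        _ ≤ ρ₀ + ‖c‖ := add_le_add hpc (dist_zero_right c).le
        _ = ‖c‖ + ρ₀ := add_comm _ _
    obtain ⟨s, hs, hps⟩ := hB.2 p hp hp0
    refine ⟨s, hs, ?_⟩
    calc dist s c ≤ dist p s + dist p c := dist_triangle_left _ _ _
      _ ≤ ε + ρ₀ := add_le_add hps hpc
      _ = ρ₀ + ε := add_comm _ _
  -- Step 4 (conjunct 5): exact laminarity of the limit.
  have hlam' : ∀ p ∈ X', ∀ q ∈ X', p 2 ≠ q 2 → (3 : ℝ) / 4 ≤ |p 2 - q 2| := by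
    intro p hp q hq hpq
    by_contra hlt
    rw [not_le] at hlt
    have hd0 : 0 < |p 2 - q 2| := abs_pos.2 (sub_ne_zero.2 hpq)
    obtain ⟨ε, hε0, hε1, hε2⟩ : ∃ ε : ℝ, 0 < ε ∧ ε ≤ |p 2 - q 2| / 8 ∧
        ε ≤ (3 / 4 - |p 2 - q 2|) / 8 :=
      ⟨min (|p 2 - q 2| / 8) ((3 / 4 - |p 2 - q 2|) / 8), lt_min (by linarith) (by linarith),
        min_le_left _ _, min_le_right _ _⟩
    obtain ⟨k, hB⟩ := (hmatch (max ‖p‖ ‖q‖) ε hε0).exists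
    obtain ⟨a, ha, hap⟩ := hB.1 p hp (by rw [dist_zero_right]; exact le_max_left _ _)
    obtain ⟨b, hb, hbq⟩ := hB.1 q hq (by rw [dist_zero_right]; exact le_max_right _ _)
    have h3 := abs_le.1 ((coord_sub_le_dist a p 2).trans hap)
    have h4 := abs_le.1 ((coord_sub_le_dist b q 2).trans hbq)
    by_cases hab : a 2 = b 2
    · have : |p 2 - q 2| ≤ 2 * ε := abs_sub_le_iff.2 ⟨by linarith, by linarith⟩
      linarith
    · have h5 := hlam (φ k) a ha b hb hab
      have : |a 2 - b 2| ≤ |p 2 - q 2| + 2 * ε :=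
        abs_sub_le_iff.2
          ⟨by linarith [le_abs_self (p 2 - q 2)], by linarith [neg_abs_le (p 2 - q 2)]⟩
      linarith
  -- Step 5 (conjunct 6): exact mirror symmetry through every particle plane `{z = p 2}`;
  -- `e₃` is the vertical unit vector.
  set e₃ : EuclideanSpace ℝ (Fin 3) := EuclideanSpace.single (2 : Fin 3) (1 : ℝ)
  have hmirror : ∀ p ∈ X', ∀ q ∈ X', q - (2 * (q 2 - p 2)) • e₃ ∈ X' := by
    intro p hp q hq
    set m := q - (2 * (q 2 - p 2)) • e₃ with hm
    -- approximate membership of the mirror image `m`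
    have happrox : ∀ ε : ℝ, 0 < ε → ε ≤ 1 → ∃ s ∈ X', dist s m ≤ 7 * ε := by
      intro ε hε hε1
      obtain ⟨k, ⟨⟨hB, hkη⟩, hk1⟩, hk2⟩ :=
        ((((hmatch (‖p‖ + ‖q‖ + ‖m‖ + 6) ε hε).and (hηev ε hε)).and (hkev (‖p‖ + 1))).and
          (hkev (3 * dist q p + 6))).exists
      obtain ⟨a, ha, hap⟩ := hB.1 p hp
        (by rw [dist_zero_right]; linarith [norm_nonneg q, norm_nonneg m])
      obtain ⟨b, hb, hbq⟩ := hB.1 q hq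
        (by rw [dist_zero_right]; linarith [norm_nonneg p, norm_nonneg m])
      have ha0 : dist a 0 ≤ (φ k : ℝ) :=
        calc dist a 0 ≤ dist a p + dist p 0 := dist_triangle _ _ _
          _ ≤ ε + ‖p‖ := by rw [dist_zero_right]; exact add_le_add hap le_rfl
          _ ≤ (φ k : ℝ) := by linarith
      have hC := hclean (φ k) a ha ha0
      -- reflect `b` through the plane of `a`
      set b' := b - (2 * (b 2 - a 2)) • e₃ with hb'
      have hb'mem : b' ∈ (fun q => q - (2 * (q 2 - a 2)) • e₃) '' Xs (φ k) := ⟨b, hb, rfl⟩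
      have hba : dist b a ≤ dist q p + 2 * ε :=
        calc dist b a ≤ dist b q + dist q a := dist_triangle _ _ _
          _ ≤ dist b q + (dist q p + dist a p) := add_le_add le_rfl (dist_triangle_right _ _ _)
          _ ≤ ε + (dist q p + ε) := add_le_add hbq (add_le_add le_rfl hap)
          _ = dist q p + 2 * ε := by ring
      have hb'a : dist b' a ≤ (φ k : ℝ) := by
        have hcoord := coord_sub_le_dist b a 2
        rw [dist_eq_norm] at hcoord ⊢
        have hid : b' - a = (b - a) - (2 * (b 2 - a 2)) • e₃ := by rw [hb', sub_right_comm]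
        rw [hid]
        calc ‖b - a - (2 * (b 2 - a 2)) • e₃‖ ≤ ‖b - a‖ + |2 * (b 2 - a 2)| :=
              norm_sub_smul_e3_le _ _
          _ ≤ ‖b - a‖ + 2 * ‖b - a‖ := by rw [abs_mul, abs_two]; linarith
          _ ≤ (φ k : ℝ) := by rw [← dist_eq_norm]; linarith
      obtain ⟨u, hu, hub'⟩ := hC.1 b' hb'mem hb'a
      -- key estimate: the reflection of `b` is `5ε`-close to `m`
      have hb'm : dist b' m ≤ 5 * ε := by
        rw [dist_eq_norm]
        have hid : b' - m = (b - q) - (2 * ((b 2 - q 2) - (a 2 - p 2))) • e₃ := by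
          have h2 : (2 * ((b 2 - q 2) - (a 2 - p 2)) : ℝ) = 2 * (b 2 - a 2) - 2 * (q 2 - p 2) := by
            ring
          rw [h2, sub_smul, hb', hm]
          abel
        rw [hid]
        have h1 : |b 2 - q 2| ≤ ε := (coord_sub_le_dist b q 2).trans hbq
        have h2 : |a 2 - p 2| ≤ ε := (coord_sub_le_dist a p 2).trans hap
        have h3 : |(b 2 - q 2) - (a 2 - p 2)| ≤ ε + ε := (abs_sub _ _).trans (add_le_add h1 h2)
        calc ‖b - q - (2 * ((b 2 - q 2) - (a 2 - p 2))) • e₃‖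
            ≤ ‖b - q‖ + |2 * ((b 2 - q 2) - (a 2 - p 2))| := norm_sub_smul_e3_le _ _
          _ ≤ ε + 2 * (ε + ε) := by
              rw [abs_mul, abs_two, ← dist_eq_norm]
              exact add_le_add hbq (mul_le_mul_of_nonneg_left h3 two_pos.le)
          _ = 5 * ε := by ring
      have hum : dist u m ≤ 6 * ε :=
        calc dist u m ≤ dist u b' + dist b' m := dist_triangle _ _ _
          _ ≤ ε + 5 * ε := add_le_add (hub'.trans hkη) hb'm
          _ = 6 * ε := by ring
      have hu0 : dist u 0 ≤ ‖p‖ + ‖q‖ + ‖m‖ + 6 :=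
        calc dist u 0 ≤ dist u m + dist m 0 := dist_triangle _ _ _
          _ ≤ 6 * ε + ‖m‖ := by rw [dist_zero_right]; exact add_le_add hum le_rfl
          _ ≤ ‖p‖ + ‖q‖ + ‖m‖ + 6 := by nlinarith [norm_nonneg p, norm_nonneg q]
      obtain ⟨s, hs, hus⟩ := hB.2 u hu hu0
      refine ⟨s, hs, ?_⟩
      calc dist s m ≤ dist u s + dist u m := dist_triangle_left _ _ _
        _ ≤ ε + 6 * ε := add_le_add hus hum
        _ = 7 * ε := by ring
    -- exact membership: the closest point of `X'` to `m` is `m`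
    have hlim : ∀ ε : ℝ, 0 < ε → ∃ s ∈ X', dist s m ≤ 0 + ε := by
      intro ε hε
      obtain ⟨s, hs, hsm⟩ :=
        happrox (min (ε / 7) 1) (lt_min (by positivity) one_pos) (min_le_right _ _)
      exact ⟨s, hs, by linarith [min_le_left (ε / 7) 1]⟩
    obtain ⟨s, hs, hsm⟩ := exists_dist_le_of_forall_pos hsep' m 0 hlim
    have hsm' : s = m := dist_le_zero.1 hsm
    exact hsm' ▸ hs
  exact ⟨φ, X', hφ, hmatch, hden', hsep', hlam', hmirror⟩

end Summit.AtomisticToContinuum.Crystallization.Theorems.PeriodicWindowsSketch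

end
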